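import Mathlib
import Summits.RiemannHypothesis.RiemannHypothesis.Theorems.WeilParityOffLineParityDetectionTorusGramIntegrals
import HarnessLib

/-!
# Smooth compactly supported cut-offs of a decaying profile (helper file for stub TORUS-SEP)

Route `WeilParity`, crux `OffLineParityDetection` (item stmt-RiemannHypothesis-15431), line
`registered`, stub `stub_torusTopHeavySeparated` (TORUS-SEP).  Pure real analysis, no zeta facts,
no definitions.

The gaining profile of Theorem SEP is `p(u) = Σ_j x_j √m_j e^{-ηu} cos(γ_j(u-a))`, smooth with
`|p(u)| ≤ A e^{-ηu}` on `u ≥ 0` but neither compactly supported nor vanishing at `0`.  The cut-offs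
`f_n(u) = χ(nu) χ(n-u) p(u)` (`χ = Real.smoothTransition`) are smooth, compactly supported, with
`tsupport f_n ⊆ [0, ∞)`, and by dominated convergence (`|f_n| ≤ |p|`, `f_n → p` pointwise on
`(0, ∞)`) every pairing `∫₀^∞ f_n k` with a continuous `k`, `|k(u)| ≤ e^{-ηu}`, tends to `∫₀^∞ p k`,
and `∫₀^∞ f_n² → ∫₀^∞ p²`.  Hence the strict top-heaviness inequality of `p` passes to some `f_n`.

Everything is folklore and fully proved.
-/

set_option linter.dupNamespace false

noncomputable section

namespace Summit.RiemannHypothesis.RiemannHypothesis.Theorems.WeilParityOffLineParityDetection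

open MeasureTheory Set Filter
open scoped Topology

/-! ## The cut-off factor -/

/-- The cut-off factor `χ(nu) χ(n-u)` is smooth. [folklore] -/
theorem torusSep_cutoff_contDiff (n : ℝ) :
    ContDiff ℝ (⊤ : ℕ∞) fun u : ℝ ↦ Real.smoothTransition (n * u) * Real.smoothTransition (n - u) :=
  (Real.smoothTransition.contDiff.comp (contDiff_const.mul contDiff_id)).mul
    (Real.smoothTransition.contDiff.comp (contDiff_const.sub contDiff_id))

/-- The cut-off factor lies in `[0, 1]`. [folklore] -/
theorem torusSep_cutoff_mem (n u : ℝ) :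
    0 ≤ Real.smoothTransition (n * u) * Real.smoothTransition (n - u) ∧
      Real.smoothTransition (n * u) * Real.smoothTransition (n - u) ≤ 1 :=
  ⟨mul_nonneg (Real.smoothTransition.nonneg _) (Real.smoothTransition.nonneg _),
    mul_le_one₀ (Real.smoothTransition.le_one _) (Real.smoothTransition.nonneg _)
      (Real.smoothTransition.le_one _)⟩

/-- The cut-off factor vanishes for `u ≤ 0` (`n ≥ 0`). [folklore] -/
theorem torusSep_cutoff_zero_of_nonpos {n u : ℝ} (hn : 0 ≤ n) (hu : u ≤ 0) :
    Real.smoothTransition (n * u) * Real.smoothTransition (n - u) = 0 := by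
  rw [Real.smoothTransition.zero_of_nonpos (mul_nonpos_of_nonneg_of_nonpos hn hu), zero_mul]

/-- The cut-off factor vanishes for `u ≥ n`. [folklore] -/
theorem torusSep_cutoff_zero_of_le {n u : ℝ} (hu : n ≤ u) :
    Real.smoothTransition (n * u) * Real.smoothTransition (n - u) = 0 := by
  rw [Real.smoothTransition.zero_of_nonpos (sub_nonpos.2 hu), mul_zero]

/-- The cut-off factor equals `1` for `1/n ≤ u ≤ n - 1`. [folklore] -/
theorem torusSep_cutoff_eq_one {n u : ℝ} (h1 : 1 ≤ n * u) (h2 : u + 1 ≤ n) :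
    Real.smoothTransition (n * u) * Real.smoothTransition (n - u) = 1 := by
  rw [Real.smoothTransition.one_of_one_le h1, Real.smoothTransition.one_of_one_le (by linarith),
    mul_one]

/-- For fixed `u > 0` the cut-off factor is eventually `1` along `n → ∞` (`n ∈ ℕ`). [folklore] -/
theorem torusSep_cutoff_eventually_one {u : ℝ} (hu : 0 < u) :
    ∀ᶠ n : ℕ in atTop, Real.smoothTransition ((n : ℝ) * u) * Real.smoothTransition ((n : ℝ) - u) = 1 := by
  obtain ⟨N, hN⟩ := exists_nat_ge (max (1 / u) (u + 1))
  refine eventually_atTop.2 ⟨N, fun n hn ↦ torusSep_cutoff_eq_one ?_ ?_⟩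
  · have h1 : 1 / u ≤ (n : ℝ) := le_trans ((le_max_left _ _).trans hN) (Nat.cast_le.2 hn)
    rw [div_le_iff₀ hu] at h1
    linarith
  · exact le_trans ((le_max_right _ _).trans hN) (Nat.cast_le.2 hn)

/-! ## The cut-off profiles -/

/-- **Admissibility of the cut-offs**: `f_n = χ(n·) χ(n-·) p` is smooth, compactly supported and
`tsupport f_n ⊆ [0, ∞)` for a smooth `p`. [folklore] -/
theorem torusSep_cutoff_admissible {p : ℝ → ℝ} (hp : ContDiff ℝ (⊤ : ℕ∞) p) (n : ℕ) {f : ℝ → ℝ}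
    (hf : ∀ u, f u = Real.smoothTransition ((n : ℝ) * u) * Real.smoothTransition ((n : ℝ) - u) * p u) :
    ContDiff ℝ (⊤ : ℕ∞) f ∧ HasCompactSupport f ∧ tsupport f ⊆ Ici 0 := by
  have hfeq : f = fun u ↦ Real.smoothTransition ((n : ℝ) * u) *
      Real.smoothTransition ((n : ℝ) - u) * p u := funext hf
  refine ⟨?_, ?_, ?_⟩
  · rw [hfeq]
    exact (torusSep_cutoff_contDiff _).mul hp
  · refine HasCompactSupport.intro (isCompact_Icc (a := (0 : ℝ)) (b := (n : ℝ))) fun u hu ↦ ?_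
    rw [hf]
    rcases lt_or_ge u 0 with h | h
    · rw [torusSep_cutoff_zero_of_nonpos (Nat.cast_nonneg n) h.le, zero_mul]
    · have h' : (n : ℝ) < u := by
        by_contra h''
        exact hu ⟨h, not_lt.1 h''⟩
      rw [torusSep_cutoff_zero_of_le h'.le, zero_mul]
  · refine closure_minimal (fun u hu ↦ ?_) isClosed_Ici
    by_contra h
    refine hu ?_
    rw [hf, torusSep_cutoff_zero_of_nonpos (Nat.cast_nonneg n) (not_le.1 h).le, zero_mul]

/-- **Pairings converge**: for `p` continuous with `|p(u)| ≤ A e^{-ηu}` (`u > 0`) and a continuous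
`k` with `|k(u)| ≤ e^{-ηu}` (`u > 0`), `∫₀^∞ f_n k → ∫₀^∞ p k` (dominated convergence, bound
`A e^{-2ηu}`). [folklore] -/
theorem torusSep_cutoff_tendsto_pairing {η : ℝ} (hη : 0 < η) {p : ℝ → ℝ} (hp : Continuous p)
    {A : ℝ} (hpA : ∀ u, 0 < u → |p u| ≤ A * Real.exp (-(η * u))) {f : ℕ → ℝ → ℝ}
    (hf : ∀ n u, f n u =
      Real.smoothTransition ((n : ℝ) * u) * Real.smoothTransition ((n : ℝ) - u) * p u)
    {k : ℝ → ℝ} (hk : Continuous k) (hk1 : ∀ u, 0 < u → |k u| ≤ Real.exp (-(η * u))) :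
    Tendsto (fun n ↦ ∫ u in Ioi (0 : ℝ), f n u * k u) atTop
      (𝓝 (∫ u in Ioi (0 : ℝ), p u * k u)) := by
  have hfeq : ∀ n, f n = fun u ↦ Real.smoothTransition ((n : ℝ) * u) *
      Real.smoothTransition ((n : ℝ) - u) * p u := fun n ↦ funext (hf n)
  have hfc : ∀ n, Continuous (f n) := fun n ↦ by
    rw [hfeq n]
    exact (torusSep_cutoff_contDiff _).continuous.mul hp
  refine tendsto_integral_of_dominated_convergence (fun u ↦ Real.exp (-(2 * η * u)) * A)
    (fun n ↦ ((hfc n).mul hk).aestronglyMeasurable) ?_ ?_ ?_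
  · have h := exp_neg_integrableOn_Ioi 0 (by positivity : 0 < 2 * η)
    refine (h.congr_fun (fun u _ ↦ ?_) measurableSet_Ioi).mul_const A
    ring_nf
  · intro n
    refine (ae_restrict_iff' measurableSet_Ioi).2 (ae_of_all _ fun u (hu : 0 < u) ↦ ?_)
    rw [Real.norm_eq_abs, abs_mul, hf]
    have hχ := torusSep_cutoff_mem (n : ℝ) u
    have h1 : |Real.smoothTransition ((n : ℝ) * u) * Real.smoothTransition ((n : ℝ) - u) * p u| ≤
        A * Real.exp (-(η * u)) := by
      rw [abs_mul, abs_of_nonneg hχ.1]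
      exact le_trans (mul_le_of_le_one_left (abs_nonneg _) hχ.2) (hpA u hu)
    have hA : 0 ≤ A := by
      have := (abs_nonneg _).trans (hpA u hu)
      exact nonneg_of_mul_nonneg_left this (Real.exp_pos _)
    calc _ ≤ A * Real.exp (-(η * u)) * Real.exp (-(η * u)) :=
          mul_le_mul h1 (hk1 u hu) (abs_nonneg _) (mul_nonneg hA (Real.exp_pos _).le)
      _ = Real.exp (-(2 * η * u)) * A := by
          rw [mul_assoc, ← Real.exp_add]
          ring_nf
  · refine (ae_restrict_iff' measurableSet_Ioi).2 (ae_of_all _ fun u (hu : 0 < u) ↦ ?_)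
    refine tendsto_const_nhds.congr' ?_
    filter_upwards [torusSep_cutoff_eventually_one hu] with n hn
    rw [hf, hn, one_mul]

/-- **Energies converge**: `∫₀^∞ f_n² → ∫₀^∞ p²` (dominated convergence, bound `A² e^{-2ηu}`).
[folklore] -/
theorem torusSep_cutoff_tendsto_sq {η : ℝ} (hη : 0 < η) {p : ℝ → ℝ} (hp : Continuous p)
    {A : ℝ} (hpA : ∀ u, 0 < u → |p u| ≤ A * Real.exp (-(η * u))) {f : ℕ → ℝ → ℝ}
    (hf : ∀ n u, f n u =
      Real.smoothTransition ((n : ℝ) * u) * Real.smoothTransition ((n : ℝ) - u) * p u) :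
    Tendsto (fun n ↦ ∫ u in Ioi (0 : ℝ), f n u ^ 2) atTop (𝓝 (∫ u in Ioi (0 : ℝ), p u ^ 2)) := by
  have hfeq : ∀ n, f n = fun u ↦ Real.smoothTransition ((n : ℝ) * u) *
      Real.smoothTransition ((n : ℝ) - u) * p u := fun n ↦ funext (hf n)
  have hfc : ∀ n, Continuous (f n) := fun n ↦ by
    rw [hfeq n]
    exact (torusSep_cutoff_contDiff _).continuous.mul hp
  refine tendsto_integral_of_dominated_convergence (fun u ↦ Real.exp (-(2 * η * u)) * A ^ 2)
    (fun n ↦ ((hfc n).pow 2).aestronglyMeasurable) ?_ ?_ ?_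
  · have h := exp_neg_integrableOn_Ioi 0 (by positivity : 0 < 2 * η)
    refine (h.congr_fun (fun u _ ↦ ?_) measurableSet_Ioi).mul_const (A ^ 2)
    ring_nf
  · intro n
    refine (ae_restrict_iff' measurableSet_Ioi).2 (ae_of_all _ fun u (hu : 0 < u) ↦ ?_)
    rw [Real.norm_eq_abs, abs_pow, hf]
    have hχ := torusSep_cutoff_mem (n : ℝ) u
    have h1 : |Real.smoothTransition ((n : ℝ) * u) * Real.smoothTransition ((n : ℝ) - u) * p u| ≤
        A * Real.exp (-(η * u)) := by
      rw [abs_mul, abs_of_nonneg hχ.1]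
      exact le_trans (mul_le_of_le_one_left (abs_nonneg _) hχ.2) (hpA u hu)
    calc _ ≤ (A * Real.exp (-(η * u))) ^ 2 := pow_le_pow_left₀ (abs_nonneg _) h1 2
      _ = Real.exp (-(2 * η * u)) * A ^ 2 := by
          rw [mul_pow, sq (Real.exp _), ← Real.exp_add]
          ring_nf
  · refine (ae_restrict_iff' measurableSet_Ioi).2 (ae_of_all _ fun u (hu : 0 < u) ↦ ?_)
    refine tendsto_const_nhds.congr' ?_
    filter_upwards [torusSep_cutoff_eventually_one hu] with n hn
    rw [hf, hn, one_mul]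

/-! ## Passing a strict inequality to a cut-off -/

/-- **Selection of the gaining profile.**  Let `p` be smooth with `|p(u)| ≤ A e^{-ηu}` (`u > 0`),
`∫₀^∞ p² > 0`, let `cᵢ, sᵢ` (`i` in a finite type) be continuous with `|cᵢ|, |sᵢ| ≤ e^{-ηu}`
(`u > 0`), weights `mᵢ` and a constant `D`, and suppose the STRICT inequality
`D ∫₀^∞ p² < Σᵢ mᵢ ((∫₀^∞ p cᵢ)² - (∫₀^∞ p sᵢ)²)`.  Then some smooth compactly supported `f` with
`tsupport f ⊆ [0, ∞)` has `∫₀^∞ f² > 0` and satisfies the same strict inequality. [folklore] -/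
theorem torusSep_cutoff_select {ι : Type*} [Fintype ι] {η : ℝ} (hη : 0 < η) {p : ℝ → ℝ}
    (hp : ContDiff ℝ (⊤ : ℕ∞) p) {A : ℝ} (hpA : ∀ u, 0 < u → |p u| ≤ A * Real.exp (-(η * u)))
    (hp2 : 0 < ∫ u in Ioi (0 : ℝ), p u ^ 2) (c s : ι → ℝ → ℝ) (hcc : ∀ i, Continuous (c i))
    (hsc : ∀ i, Continuous (s i)) (hc1 : ∀ i u, 0 < u → |c i u| ≤ Real.exp (-(η * u)))
    (hs1 : ∀ i u, 0 < u → |s i u| ≤ Real.exp (-(η * u))) (m : ι → ℝ) (D : ℝ)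
    (hstrict : D * ∫ u in Ioi (0 : ℝ), p u ^ 2 <
      ∑ i, m i * ((∫ u in Ioi (0 : ℝ), p u * c i u) ^ 2 - (∫ u in Ioi (0 : ℝ), p u * s i u) ^ 2)) :
    ∃ f : ℝ → ℝ, ContDiff ℝ (⊤ : ℕ∞) f ∧ HasCompactSupport f ∧ tsupport f ⊆ Ici 0 ∧
      0 < ∫ u in Ioi (0 : ℝ), f u ^ 2 ∧
      D * ∫ u in Ioi (0 : ℝ), f u ^ 2 <
        ∑ i, m i * ((∫ u in Ioi (0 : ℝ), f u * c i u) ^ 2 - (∫ u in Ioi (0 : ℝ), f u * s i u) ^ 2) := by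
  set f : ℕ → ℝ → ℝ := fun n u ↦
    Real.smoothTransition ((n : ℝ) * u) * Real.smoothTransition ((n : ℝ) - u) * p u with hfdef
  have hf : ∀ n u, f n u =
      Real.smoothTransition ((n : ℝ) * u) * Real.smoothTransition ((n : ℝ) - u) * p u :=
    fun n u ↦ rfl
  have hsq := torusSep_cutoff_tendsto_sq hη hp.continuous hpA hf
  have hgain : Tendsto (fun n ↦ ∑ i, m i * ((∫ u in Ioi (0 : ℝ), f n u * c i u) ^ 2 -
      (∫ u in Ioi (0 : ℝ), f n u * s i u) ^ 2) - D * ∫ u in Ioi (0 : ℝ), f n u ^ 2) atTop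
      (𝓝 (∑ i, m i * ((∫ u in Ioi (0 : ℝ), p u * c i u) ^ 2 -
        (∫ u in Ioi (0 : ℝ), p u * s i u) ^ 2) - D * ∫ u in Ioi (0 : ℝ), p u ^ 2)) := by
    refine Tendsto.sub (tendsto_finsetSum _ fun i _ ↦ Tendsto.const_mul _ (Tendsto.sub ?_ ?_))
      (hsq.const_mul D)
    · exact (torusSep_cutoff_tendsto_pairing hη hp.continuous hpA hf (hcc i) (hc1 i)).pow 2
    · exact (torusSep_cutoff_tendsto_pairing hη hp.continuous hpA hf (hsc i) (hs1 i)).pow 2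
  have h1 : ∀ᶠ n in atTop, 0 < ∑ i, m i * ((∫ u in Ioi (0 : ℝ), f n u * c i u) ^ 2 -
      (∫ u in Ioi (0 : ℝ), f n u * s i u) ^ 2) - D * ∫ u in Ioi (0 : ℝ), f n u ^ 2 :=
    hgain.eventually (lt_mem_nhds (by linarith))
  have h2 : ∀ᶠ n in atTop, 0 < ∫ u in Ioi (0 : ℝ), f n u ^ 2 := hsq.eventually (lt_mem_nhds hp2)
  obtain ⟨n, hn1, hn2⟩ := (h1.and h2).exists
  obtain ⟨hA1, hA2, hA3⟩ := torusSep_cutoff_admissible hp n (hf n)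
  exact ⟨f n, hA1, hA2, hA3, hn2, by linarith⟩

/-! ## Summary statement (the registered sub-goal of this helper file) -/

/-- **Cut-off selection** (closed form of `torusSep_cutoff_select`; see the module docstring).
[folklore] -/
theorem torusSep_gramCutoff :
    ∀ (ι : Type) [Fintype ι] (η : ℝ), 0 < η → ∀ (p : ℝ → ℝ), ContDiff ℝ (⊤ : ℕ∞) p →
      ∀ A : ℝ, (∀ u, 0 < u → |p u| ≤ A * Real.exp (-(η * u))) →
      0 < ∫ u in Set.Ioi (0 : ℝ), p u ^ 2 →
      ∀ (c s : ι → ℝ → ℝ), (∀ i, Continuous (c i)) → (∀ i, Continuous (s i)) →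
      (∀ i u, 0 < u → |c i u| ≤ Real.exp (-(η * u))) →
      (∀ i u, 0 < u → |s i u| ≤ Real.exp (-(η * u))) → ∀ (m : ι → ℝ) (D : ℝ),
      D * ∫ u in Set.Ioi (0 : ℝ), p u ^ 2 <
        ∑ i, m i * ((∫ u in Set.Ioi (0 : ℝ), p u * c i u) ^ 2 -
          (∫ u in Set.Ioi (0 : ℝ), p u * s i u) ^ 2) →
      ∃ f : ℝ → ℝ, ContDiff ℝ (⊤ : ℕ∞) f ∧ HasCompactSupport f ∧ tsupport f ⊆ Set.Ici 0 ∧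
        0 < ∫ u in Set.Ioi (0 : ℝ), f u ^ 2 ∧
        D * ∫ u in Set.Ioi (0 : ℝ), f u ^ 2 <
          ∑ i, m i * ((∫ u in Set.Ioi (0 : ℝ), f u * c i u) ^ 2 -
            (∫ u in Set.Ioi (0 : ℝ), f u * s i u) ^ 2) :=
  fun _ _ _ hη _ hp _ hpA hp2 c s hcc hsc hc1 hs1 m D hstrict ↦
    torusSep_cutoff_select hη hp hpA hp2 c s hcc hsc hc1 hs1 m D hstrict

end Summit.RiemannHypothesis.RiemannHypothesis.Theorems.WeilParityOffLineParityDetection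

end
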